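import Summits.Ventures.YMGap.RobustBall.TorusOneLink
import Summits.Ventures.YMGap.Thresholds.StarWindowBoundSUN
import HarnessLib

/-!
# Venture YMGap, track ROBUST-BALL (Y2) — crux Y2-X2 for the FULL tier-1 ball, step 1: the GAUGE side of
# Lemma G for the PERTURBED torus specification

HONEST FRAMING. WHAT THIS IS: a venture file (cell `pub-ymgap`, track Y2 ROBUST-BALL, seat ds-2).
Measure-theoretic identities, NO estimate and NO number: the four gauge lemmas of
`Thresholds/StarGaugeInvariance.lean` (stated there for the torus weight specification `torusWeightSpec v`
of a class-function plaquette weight) hold VERBATIM for the perturbed torus specification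
`perturbedTorusSpec W β` of EVERY member `W` of the ball's carrier (`RobustBall/Defs.lean`): the carrier is
the tree's `QuasiLocalGaugePerturbation d L SU(N) 1`, whose activities are gauge invariant by definition
(`gaugeInvariant'`, `isGaugeInvariant_total`), so the perturbed energy `∑_q log v_β(U_q) − W.total U` is
gauge invariant and the whole argument of `StarGaugeInvariance` (invariant energy + product Haar measure
preserved on `Λ` + gluing intertwines the gauge actions) goes through:
* `perturbedTorusSpec_map_gaugeTransform` — GAUGE COVARIANCE `(γ_Λ(·|η)).map (U ↦ U^g) = γ_Λ(·|η^g)`;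
* `perturbedTorusSpec_map_gaugeAt` — invariance of every kernel whose volume contains the vertex star of
  `s` under the gauge transformations at `s`;
* `integral_gaugeAvg_perturbedTorusSpec`, `perturbed_integral_sub_integral_eq_gaugeAvg` — the window
  hypothesis (H1) need only be checked on observables invariant at the centre;
* `integral_perturbedTorusSpec_eq_erase` — the FROZEN-LINK IDENTITY `∫ f dγ_Λ(·|η) = ∫ f dγ_{Λ∖{a}}(·|η^{a←1})`
  for `f` invariant at `s` and a star link `a ∈ Λ`.
This is the input of the robust vertex-star door (crux Y2-X2 for polymers larger than a plaquette;
`RobustStarWindow.lean`). WHAT THIS IS NOT: no Dobrushin matrix, no comparison, no clustering statement;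
strong-coupling LATTICE bookkeeping on a finite torus — nothing about the continuum or the Millennium problem.

## References
* E. Seiler, LNP 159 (1982) Ch. 2; H.-O. Georgii, *Gibbs Measures and Phase Transitions* (2011) §5.2.
* The tree: `Thresholds/StarGaugeInvariance.lean` (ds-2 g3; followed line by line),
  `RobustBall/TorusOneLink.lean` (`isSpecification_perturbedTorusSpec`).
-/

noncomputable section

open MeasureTheory Function Finset
open Literature.Probability.LatticeModels
open Literature.Probability.LatticeModels.DobrushinMetric (integrable_of_abs_le')
open Literature.MathematicalPhysics.QuantumLattice (integral_integral_eq_of_lintegral_eq)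
open Literature.MathematicalPhysics.QuantumFieldTheory hiding ZdEdge
open Literature.MathematicalPhysics.QuantumFieldTheory.Balaban1983to89.StrongCouplingTorusWindow (wilsonPlaqWeight)
open Summit.Ventures.YMGap.StarGauge
open Summit.Ventures.YMGap.StarLemmaGSUN (wilsonPlaqWeight_conj)

namespace Summit.Ventures.YMGap.RobustBall

variable {d L N : ℕ} [NeZero L] (W : Perturbation d L N) (β : ℝ)

/-! ### Gauge invariance of the perturbed energy; the kernel reads the boundary condition off `Λ` -/

/-- **The perturbed torus energy is gauge invariant**: the Wilson weight is a class function
(`torusLogWeight_gaugeTransform`) and every activity of a member is gauge invariant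
(`QuasiLocalGaugePerturbation.isGaugeInvariant_total`). [folklore] -/
theorem perturbedTorusEnergy_gaugeTransform (g : Site d L → SUN N) (U : GaugeConfig d L (SUN N)) :
    torusLogWeight (wilsonPlaqWeight N β) (gaugeTransform g U) - W.total (gaugeTransform g U) =
      torusLogWeight (wilsonPlaqWeight N β) U - W.total U := by
  rw [torusLogWeight_gaugeTransform (wilsonPlaqWeight_conj β) g U, W.isGaugeInvariant_total g U]

/-- **The perturbed kernel reads the boundary condition only off `Λ`**: `γ_Λ(· | η) = γ_Λ(· | η')` if
`η = η'` off `Λ`. [folklore] -/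
theorem perturbedTorusSpec_congr_off (Λ : Finset (Edge d L)) {η η' : GaugeConfig d L (SUN N)}
    (h : ∀ e, e ∉ Λ → η e = η' e) : perturbedTorusSpec W β Λ η = perturbedTorusSpec W β Λ η' := by
  unfold perturbedTorusSpec
  have hfun : (fun ζ : ↥Λ → SUN N => glueWith Λ ζ η) = fun ζ => glueWith Λ ζ η' :=
    funext fun ζ => glueWith_congr_off Λ ζ h
  rw [hfun]

/-! ### Gauge covariance of the perturbed torus specification -/

/-- **GAUGE COVARIANCE OF THE PERTURBED TORUS SPECIFICATION**: `(γ_Λ(· | η)).map (U ↦ U^g) = γ_Λ(· | η^g)`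
— invariant energy (`map_tilted_comp`), product Haar measure preserved on `Λ`, gluing intertwines
(port of `StarGauge.torusWeightSpec_map_gaugeTransform`). [folklore] -/
theorem perturbedTorusSpec_map_gaugeTransform (Λ : Finset (Edge d L)) (g : Site d L → SUN N)
    (η : GaugeConfig d L (SUN N)) :
    (perturbedTorusSpec W β Λ η).map (gaugeTransform g) = perturbedTorusSpec W β Λ (gaugeTransform g η) := by
  unfold perturbedTorusSpec
  set E : GaugeConfig d L (SUN N) → ℝ := fun U => torusLogWeight (wilsonPlaqWeight N β) U - W.total U with hE
  have hW : Measurable E := measurable_perturbedTorusEnergy W β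
  have hT : Measurable (gaugeTransform g : GaugeConfig d L (SUN N) → GaugeConfig d L (SUN N)) :=
    measurable_gaugeTransform g
  have hinv : E ∘ gaugeTransform g = E := funext fun U => perturbedTorusEnergy_gaugeTransform W β g U
  set μ : Measure (GaugeConfig d L (SUN N)) :=
    (Measure.pi fun _ : ↥Λ => haarProbability (SUN N)).map (glueWith Λ · η) with hμ
  -- tilt and push-forward commute because the energy is invariant
  have h1 : (μ.tilted E).map (gaugeTransform g) = (μ.map (gaugeTransform g)).tilted E := by
    conv_lhs => rw [← hinv]
    exact map_tilted_comp μ hT hW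
  rw [h1]
  congr 1
  -- the glued product Haar measure is gauge covariant
  rw [hμ, Measure.map_map hT (measurable_glueWith Λ η)]
  have hcomp : (gaugeTransform g ∘ fun ζ : ↥Λ → SUN N => glueWith Λ ζ η) =
      (fun ζ : ↥Λ → SUN N => glueWith Λ ζ (gaugeTransform g η)) ∘ gaugeTransformOn Λ g :=
    funext fun ζ => gaugeTransform_glueWith Λ g ζ η
  rw [hcomp, ← Measure.map_map (measurable_glueWith Λ _) (measurePreserving_gaugeTransformOn Λ g).measurable,
    (measurePreserving_gaugeTransformOn Λ g).map_eq]

/-- **INVARIANCE OF THE PERTURBED STAR KERNEL.** If `Λ` contains the vertex star of `s`, the kernel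
`γ_Λ(· | η)` of the perturbed specification is invariant under the gauge transformations at `s`:
`(γ_Λ(· | η)).map (U ↦ U^{g at s}) = γ_Λ(· | η)`. [folklore] -/
theorem perturbedTorusSpec_map_gaugeAt {Λ : Finset (Edge d L)} {s : Site d L}
    (hΛ : ∀ e : Edge d L, (e.1 = s ∨ e.1.shift e.2 = s) → e ∈ Λ) (g : SUN N) (η : GaugeConfig d L (SUN N)) :
    (perturbedTorusSpec W β Λ η).map (gaugeTransform (gaugeAt s g)) = perturbedTorusSpec W β Λ η := by
  rw [perturbedTorusSpec_map_gaugeTransform W β Λ (gaugeAt s g) η]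
  exact perturbedTorusSpec_congr_off W β Λ fun e he =>
    gaugeTransform_gaugeAt_apply_of_not_star g fun hes => he (hΛ e hes)

/-! ### The gauge average against the perturbed star kernels; the frozen-link identity -/

/-- **Same integral against every star-containing perturbed kernel**:
`∫ gaugeAvg s f dγ_Λ(· | η) = ∫ f dγ_Λ(· | η)` (Fubini and `perturbedTorusSpec_map_gaugeAt`). [folklore] -/
theorem integral_gaugeAvg_perturbedTorusSpec {Λ : Finset (Edge d L)} {s : Site d L}
    (hΛ : ∀ e : Edge d L, (e.1 = s ∨ e.1.shift e.2 = s) → e ∈ Λ) (η : GaugeConfig d L (SUN N))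
    {f : GaugeConfig d L (SUN N) → ℝ} (hfm : Measurable f) {M : ℝ} (hM : ∀ U, |f U| ≤ M) :
    ∫ U, gaugeAvg s f U ∂(perturbedTorusSpec W β Λ η) = ∫ U, f U ∂(perturbedTorusSpec W β Λ η) := by
  haveI : SecondCountableTopology (Matrix (Fin N) (Fin N) ℂ) :=
    inferInstanceAs (SecondCountableTopology (Fin N → Fin N → ℂ))
  haveI : SecondCountableTopology (SUN N) := Topology.IsEmbedding.subtypeVal.secondCountableTopology
  haveI := (isSpecification_perturbedTorusSpec W β).isProbability Λ η
  set μ := perturbedTorusSpec W β Λ η with hμ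
  -- Fubini
  have hint : Integrable (uncurry fun (U : GaugeConfig d L (SUN N)) (g : SUN N) =>
      f (gaugeTransform (gaugeAt s g) U)) (μ.prod (haarProbability (SUN N))) :=
    Integrable.of_bound (measurable_uncurry_gaugeActionAt s hfm).aestronglyMeasurable M
      (ae_of_all _ fun p => by rw [Real.norm_eq_abs]; exact hM _)
  have hswap := integral_integral_swap hint
  unfold gaugeAvg
  rw [hswap]
  -- each inner integral is `∫ f dμ` by invariance of the kernel
  have hinner : ∀ g : SUN N, ∫ U, f (gaugeTransform (gaugeAt s g) U) ∂μ = ∫ U, f U ∂μ := fun g => by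
    rw [← integral_map (measurable_gaugeTransform (gaugeAt s g)).aemeasurable hfm.aestronglyMeasurable,
      hμ, perturbedTorusSpec_map_gaugeAt W β hΛ g η]
  simp_rw [hinner]
  simp

/-- **REDUCTION OF (H1) TO INVARIANT OBSERVABLES, perturbed specification**: the difference of two
star-containing perturbed kernel integrals of `f` equals that of its gauge average at `s`. [folklore] -/
theorem perturbed_integral_sub_integral_eq_gaugeAvg {Λ : Finset (Edge d L)} {s : Site d L}
    (hΛ : ∀ e : Edge d L, (e.1 = s ∨ e.1.shift e.2 = s) → e ∈ Λ) (ω η : GaugeConfig d L (SUN N))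
    {f : GaugeConfig d L (SUN N) → ℝ} (hfm : Measurable f) {M : ℝ} (hM : ∀ U, |f U| ≤ M) :
    ∫ U, f U ∂(perturbedTorusSpec W β Λ ω) - ∫ U, f U ∂(perturbedTorusSpec W β Λ η) =
      ∫ U, gaugeAvg s f U ∂(perturbedTorusSpec W β Λ ω) -
        ∫ U, gaugeAvg s f U ∂(perturbedTorusSpec W β Λ η) := by
  rw [integral_gaugeAvg_perturbedTorusSpec W β hΛ ω hfm hM, integral_gaugeAvg_perturbedTorusSpec W β hΛ η hfm hM]

/-- **THE FROZEN-LINK IDENTITY, perturbed specification.** For a member `W`, a volume `Λ` containing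
the vertex star of `s`, a star link `a`, torus side `≥ 2` and a bounded measurable `f` invariant under the
gauge transformations at `s`: `∫ f dγ_Λ(· | η) = ∫ f dγ_{Λ∖{a}}(· | η^{a ← 1})` (the link `a` FROZEN to
`1`). Proof: consistency `γ_Λ f = γ_Λ(γ_{Λ∖{a}} f)`; by covariance and invariance of `f` the inner
integral is unchanged when `σ_a` is gauged to `1`; properness (port of
`StarGauge.integral_torusWeightSpec_eq_erase`). [folklore] -/
theorem integral_perturbedTorusSpec_eq_erase (hL : 1 < L) {Λ : Finset (Edge d L)} {s : Site d L}
    (hΛ : ∀ e : Edge d L, (e.1 = s ∨ e.1.shift e.2 = s) → e ∈ Λ) {a : Edge d L}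
    (ha : a.1 = s ∨ a.1.shift a.2 = s) (η : GaugeConfig d L (SUN N)) {f : GaugeConfig d L (SUN N) → ℝ}
    (hfm : Measurable f) {M : ℝ} (hM : ∀ U, |f U| ≤ M)
    (hfinv : ∀ (g : SUN N) (U : GaugeConfig d L (SUN N)), f (gaugeTransform (gaugeAt s g) U) = f U) :
    ∫ U, f U ∂(perturbedTorusSpec W β Λ η) =
      ∫ U, f U ∂(perturbedTorusSpec W β (Λ.erase a) (Function.update η a 1)) := by
  classical
  haveI : SecondCountableTopology (Matrix (Fin N) (Fin N) ℂ) :=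
    inferInstanceAs (SecondCountableTopology (Fin N → Fin N → ℂ))
  haveI : SecondCountableTopology (SUN N) := Topology.IsEmbedding.subtypeVal.secondCountableTopology
  have hγ := isSpecification_perturbedTorusSpec W β
  haveI := hγ.isProbability Λ η
  -- consistency: `γ_Λ f = γ_Λ (γ_{Λ∖{a}} f)`
  have hcons : ∫ σ, ∫ U, f U ∂(perturbedTorusSpec W β (Λ.erase a) σ) ∂(perturbedTorusSpec W β Λ η) =
      ∫ U, f U ∂(perturbedTorusSpec W β Λ η) :=
    integral_integral_eq_of_lintegral_eq hγ (Λ.erase a)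
      (fun A hA => hγ.consistent (Finset.erase_subset a Λ) η A hA) (integrable_of_abs_le' hfm hM)
  rw [← hcons]
  -- the inner integral is a.e. constant
  have hkey : ∀ σ : GaugeConfig d L (SUN N), (∀ e, e ∉ Λ → σ e = η e) →
      ∫ U, f U ∂(perturbedTorusSpec W β (Λ.erase a) σ) =
        ∫ U, f U ∂(perturbedTorusSpec W β (Λ.erase a) (Function.update η a 1)) := by
    intro σ hσ
    obtain ⟨g, hg⟩ := exists_gaugeAt_apply_eq_one (G := SUN N) hL ha σ
    -- gauge `σ` at `s` so that the link `a` becomes `1`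
    have h1 : ∫ U, f U ∂(perturbedTorusSpec W β (Λ.erase a) σ) =
        ∫ U, f U ∂(perturbedTorusSpec W β (Λ.erase a) (gaugeTransform (gaugeAt s g) σ)) := by
      rw [← perturbedTorusSpec_map_gaugeTransform W β (Λ.erase a) (gaugeAt s g) σ,
        integral_map (measurable_gaugeTransform _).aemeasurable hfm.aestronglyMeasurable]
      simp_rw [hfinv]
    rw [h1]
    refine congrArg (fun m => ∫ U, f U ∂m) (perturbedTorusSpec_congr_off W β (Λ.erase a) fun e he => ?_)
    by_cases hea : e = a
    · subst hea
      rw [hg, Function.update_self]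
    · have heΛ : e ∉ Λ := fun h => he (Finset.mem_erase.2 ⟨hea, h⟩)
      rw [Function.update_of_ne hea, gaugeTransform_gaugeAt_apply_of_not_star g fun h => heΛ (hΛ e h),
        hσ e heΛ]
  have hae : (fun σ => ∫ U, f U ∂(perturbedTorusSpec W β (Λ.erase a) σ)) =ᵐ[perturbedTorusSpec W β Λ η]
      fun _ => ∫ U, f U ∂(perturbedTorusSpec W β (Λ.erase a) (Function.update η a 1)) := by
    filter_upwards [hγ.proper Λ η] with σ hσ
    exact hkey σ hσ
  rw [integral_congr_ae hae, integral_const, smul_eq_mul]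
  simp

end Summit.Ventures.YMGap.RobustBall

end
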